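import Mathlib
import Summits.ValiantsHypothesis.ValiantsHypothesis.Theorems.ProofCarryingSymmetryRestorationQPACFormula

/-!
# Route ProofCarryingSymmetry — crux `RestorationQP`, line `registered`, stub S3 (`stub_stabilityAtACBudget`), part 2:
flattening and the AC-quotient DAG of Hrubeš–Tzameret formulas

Continuation of `…RestorationQPACFormula.lean` (`ACStability.ACEq`, formulas modulo A2–A5):

* `addArgs F` / `mulArgs F` — the maximal `+`-chain (`×`-chain) decomposition of the root of `F`
  (the children of the root of the FLATTENED, unbounded fan-in form of `F`); `kids F` = the one
  matching the head of `F`; `eval F = Σ (addArgs F).map eval = Π (mulArgs F).map eval`; members of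
  `kids F` are strictly smaller; renaming commutes with all three;
* the key invariance `ACEq.kids_map_mk_eq`: AC-equivalent formulas have the same MULTISET of
  AC-classes of flattened children — flattening is a complete invariant one level down;
* hence the quotient `ACClass 𝔽 X = PIFormula 𝔽 X ⧸ ACEq` is an unbounded fan-in DAG: `ACClass.kids :
  ACClass → Multiset ACClass`, with `label`, `size`, `eval` descending to the quotient, `eval` of a
  `+`-class the sum over its kids (of a `×`-class the product), kids strictly smaller, leaf classes
  determined by their label.  (The group action and the reachable sub-DAG of a circuit are in part 3,
  `…ACReach.lean`.)

Everything proved; no named facts. (HT = Hrubeš–Tzameret arXiv:1112.6265 §1.1; the labels are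
Dawar–Wilsenach's `CircuitLabel`, ToC 2025 Def. 2.2.)
-/

-- single-problem summit: `Summit.ValiantsHypothesis.ValiantsHypothesis.…` is the namespace by design (D-0017)
set_option linter.dupNamespace false

noncomputable section

namespace Summit.ValiantsHypothesis.ValiantsHypothesis.Theorems

namespace ACStability

open Literature.Computability.AlgebraicComplexity

universe u v w

variable {𝔽 : Type u} {X : Type v} {Y : Type w}

/-! ### Flattening one level: the maximal `+`-chain and `×`-chain of the root -/

/-- `addArgs F`: the summands of the maximal `+`-chain at the root of `F` (`F` itself if its head
is not `+`) — the children of the root of the flattened form of `F`. [folklore] -/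
def addArgs : PIFormula 𝔽 X → List (PIFormula 𝔽 X)
  | .add F G => addArgs F ++ addArgs G
  | F => [F]

/-- `mulArgs F`: the factors of the maximal `×`-chain at the root of `F`. [folklore] -/
def mulArgs : PIFormula 𝔽 X → List (PIFormula 𝔽 X)
  | .mul F G => mulArgs F ++ mulArgs G
  | F => [F]

/-- Unfolding of `addArgs` at a `+` node. [folklore] -/
@[simp] theorem addArgs_add (F G : PIFormula 𝔽 X) : addArgs (.add F G) = addArgs F ++ addArgs G := rfl
/-- Unfolding of `mulArgs` at a `×` node. [folklore] -/
@[simp] theorem mulArgs_mul (F G : PIFormula 𝔽 X) : mulArgs (.mul F G) = mulArgs F ++ mulArgs G := rfl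

/-- A formula whose head is not `+` is its own single summand. [folklore] -/
theorem addArgs_of_ne {F : PIFormula 𝔽 X} (h : headLabel F ≠ .add) : addArgs F = [F] := by
  cases F <;> simp_all [addArgs]

/-- A formula whose head is not `×` is its own single factor. [folklore] -/
theorem mulArgs_of_ne {F : PIFormula 𝔽 X} (h : headLabel F ≠ .mul) : mulArgs F = [F] := by
  cases F <;> simp_all [mulArgs]

/-- `kids F`: the children of the root of the flattened form of `F` — the `+`-summands of a `+`
node, the `×`-factors of a `×` node, nothing for a leaf. [folklore] -/
def kids : PIFormula 𝔽 X → List (PIFormula 𝔽 X)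
  | .add F G => addArgs F ++ addArgs G
  | .mul F G => mulArgs F ++ mulArgs G
  | _ => []

/-- Unfolding of `kids`. [folklore] -/
@[simp] theorem kids_var (x : X) : kids (.var x : PIFormula 𝔽 X) = [] := rfl
/-- Unfolding of `kids`. [folklore] -/
@[simp] theorem kids_const (c : 𝔽) : kids (.const c : PIFormula 𝔽 X) = [] := rfl
/-- Unfolding of `kids`. [folklore] -/
@[simp] theorem kids_add (F G : PIFormula 𝔽 X) : kids (.add F G) = addArgs F ++ addArgs G := rfl
/-- Unfolding of `kids`. [folklore] -/
@[simp] theorem kids_mul (F G : PIFormula 𝔽 X) : kids (.mul F G) = mulArgs F ++ mulArgs G := rfl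

/-- The value of a formula is the sum of its `+`-summands. [folklore] -/
theorem eval_eq_sum_addArgs [CommSemiring 𝔽] (F : PIFormula 𝔽 X) :
    F.eval = ((addArgs F).map PIFormula.eval).sum := by
  induction F with
  | var x => simp [addArgs]
  | const c => simp [addArgs]
  | add F G ihF ihG => simp [ihF, ihG]
  | mul F G _ _ => simp [addArgs]

/-- The value of a formula is the product of its `×`-factors. [folklore] -/
theorem eval_eq_prod_mulArgs [CommSemiring 𝔽] (F : PIFormula 𝔽 X) :
    F.eval = ((mulArgs F).map PIFormula.eval).prod := by
  induction F with
  | var x => simp [mulArgs]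
  | const c => simp [mulArgs]
  | add F G _ _ => simp [mulArgs]
  | mul F G ihF ihG => simp [ihF, ihG]

/-- Summands are at most as large as the formula. [folklore] -/
theorem size_le_of_mem_addArgs {F K : PIFormula 𝔽 X} (h : K ∈ addArgs F) : K.size ≤ F.size := by
  induction F with
  | var x => simp [addArgs] at h; simp [h]
  | const c => simp [addArgs] at h; simp [h]
  | add F G ihF ihG =>
    simp only [addArgs_add, List.mem_append] at h
    rcases h with h | h
    · exact (ihF h).trans (by simp; omega)
    · exact (ihG h).trans (by simp; omega)
  | mul F G _ _ => simp [addArgs] at h; simp [h]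

/-- Factors are at most as large as the formula. [folklore] -/
theorem size_le_of_mem_mulArgs {F K : PIFormula 𝔽 X} (h : K ∈ mulArgs F) : K.size ≤ F.size := by
  induction F with
  | var x => simp [mulArgs] at h; simp [h]
  | const c => simp [mulArgs] at h; simp [h]
  | add F G _ _ => simp [mulArgs] at h; simp [h]
  | mul F G ihF ihG =>
    simp only [mulArgs_mul, List.mem_append] at h
    rcases h with h | h
    · exact (ihF h).trans (by simp; omega)
    · exact (ihG h).trans (by simp; omega)

/-- Children of the flattened root are strictly smaller. [folklore] -/
theorem size_lt_of_mem_kids {F K : PIFormula 𝔽 X} (h : K ∈ kids F) : K.size < F.size := by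
  cases F with
  | var x => simp at h
  | const c => simp at h
  | add F G =>
    simp only [kids_add, List.mem_append] at h
    rcases h with h | h
    · exact lt_of_le_of_lt (size_le_of_mem_addArgs h) (by simp only [PIFormula.size_add]; omega)
    · exact lt_of_le_of_lt (size_le_of_mem_addArgs h) (by simp only [PIFormula.size_add]; omega)
  | mul F G =>
    simp only [kids_mul, List.mem_append] at h
    rcases h with h | h
    · exact lt_of_le_of_lt (size_le_of_mem_mulArgs h) (by simp only [PIFormula.size_mul]; omega)
    · exact lt_of_le_of_lt (size_le_of_mem_mulArgs h) (by simp only [PIFormula.size_mul]; omega)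

/-- A `+` node has at least two summands; in general `addArgs` is nonempty. [folklore] -/
theorem one_le_length_addArgs (F : PIFormula 𝔽 X) : 1 ≤ (addArgs F).length := by
  induction F with
  | add F G ihF _ => simp; omega
  | _ => simp [addArgs]

/-- `mulArgs` is nonempty. [folklore] -/
theorem one_le_length_mulArgs (F : PIFormula 𝔽 X) : 1 ≤ (mulArgs F).length := by
  induction F with
  | mul F G ihF _ => simp; omega
  | _ => simp [mulArgs]

/-- An internal node has at least two flattened children. [folklore] -/
theorem two_le_length_kids {F : PIFormula 𝔽 X} (h : ¬ (headLabel F).IsInput) : 2 ≤ (kids F).length := by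
  cases F with
  | var x => simp [headLabel] at h
  | const c => simp [headLabel] at h
  | add F G =>
    have := one_le_length_addArgs F; have := one_le_length_addArgs G
    simp; omega
  | mul F G =>
    have := one_le_length_mulArgs F; have := one_le_length_mulArgs G
    simp; omega

/-- Leaves have no flattened children. [folklore] -/
theorem kids_eq_nil_of_isInput {F : PIFormula 𝔽 X} (h : (headLabel F).IsInput) : kids F = [] := by
  cases F <;> simp_all [headLabel]

/-- Renaming commutes with `addArgs`. [folklore] -/
theorem addArgs_rename (f : X → Y) (F : PIFormula 𝔽 X) :
    addArgs (F.rename f) = (addArgs F).map (PIFormula.rename f) := by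
  induction F with
  | add F G ihF ihG => simp [PIFormula.rename, ihF, ihG]
  | _ => rfl

/-- Renaming commutes with `mulArgs`. [folklore] -/
theorem mulArgs_rename (f : X → Y) (F : PIFormula 𝔽 X) :
    mulArgs (F.rename f) = (mulArgs F).map (PIFormula.rename f) := by
  induction F with
  | mul F G ihF ihG => simp [PIFormula.rename, ihF, ihG]
  | _ => rfl

/-- Renaming commutes with `kids`. [folklore] -/
theorem kids_rename (f : X → Y) (F : PIFormula 𝔽 X) :
    kids (F.rename f) = (kids F).map (PIFormula.rename f) := by
  cases F with
  | var x => rfl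
  | const c => rfl
  | add F G => simp [PIFormula.rename, addArgs_rename]
  | mul F G => simp [PIFormula.rename, mulArgs_rename]

/-! ### Flattening is a complete invariant one level down -/

/-- AC-equivalent formulas have the same multiset of AC-classes of `+`-summands. [folklore] -/
theorem ACEq.addArgs_map_mk_eq {F G : PIFormula 𝔽 X} (h : ACEq F G) :
    (((addArgs F).map (Quotient.mk (acSetoid 𝔽 X)) : List _) : Multiset (Quotient (acSetoid 𝔽 X))) =
      ((addArgs G).map (Quotient.mk (acSetoid 𝔽 X)) : List _) := by
  induction h with
  | refl F => rfl
  | symm _ ih => exact ih.symm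
  | trans _ _ ih₁ ih₂ => exact ih₁.trans ih₂
  | add_congr _ _ ih₁ ih₂ =>
    simp only [addArgs_add, List.map_append, ← Multiset.coe_add, ih₁, ih₂]
  | mul_congr h₁ h₂ _ _ =>
    simp only [addArgs, List.map_cons, List.map_nil, Multiset.coe_singleton, Multiset.singleton_inj]
    exact Quotient.sound (ACEq.mul_congr h₁ h₂)
  | add_comm F G =>
    simp only [addArgs_add, List.map_append, ← Multiset.coe_add, _root_.add_comm]
  | add_assoc F G H =>
    simp only [addArgs_add, List.map_append, List.append_assoc]
  | mul_comm F G =>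
    simp only [addArgs, List.map_cons, List.map_nil, Multiset.coe_singleton, Multiset.singleton_inj]
    exact Quotient.sound (ACEq.mul_comm F G)
  | mul_assoc F G H =>
    simp only [addArgs, List.map_cons, List.map_nil, Multiset.coe_singleton, Multiset.singleton_inj]
    exact Quotient.sound (ACEq.mul_assoc F G H)

/-- AC-equivalent formulas have the same multiset of AC-classes of `×`-factors. [folklore] -/
theorem ACEq.mulArgs_map_mk_eq {F G : PIFormula 𝔽 X} (h : ACEq F G) :
    (((mulArgs F).map (Quotient.mk (acSetoid 𝔽 X)) : List _) : Multiset (Quotient (acSetoid 𝔽 X))) =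
      ((mulArgs G).map (Quotient.mk (acSetoid 𝔽 X)) : List _) := by
  induction h with
  | refl F => rfl
  | symm _ ih => exact ih.symm
  | trans _ _ ih₁ ih₂ => exact ih₁.trans ih₂
  | mul_congr _ _ ih₁ ih₂ =>
    simp only [mulArgs_mul, List.map_append, ← Multiset.coe_add, ih₁, ih₂]
  | add_congr h₁ h₂ _ _ =>
    simp only [mulArgs, List.map_cons, List.map_nil, Multiset.coe_singleton, Multiset.singleton_inj]
    exact Quotient.sound (ACEq.add_congr h₁ h₂)
  | mul_comm F G =>
    simp only [mulArgs_mul, List.map_append, ← Multiset.coe_add, _root_.add_comm]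
  | mul_assoc F G H =>
    simp only [mulArgs_mul, List.map_append, List.append_assoc]
  | add_comm F G =>
    simp only [mulArgs, List.map_cons, List.map_nil, Multiset.coe_singleton, Multiset.singleton_inj]
    exact Quotient.sound (ACEq.add_comm F G)
  | add_assoc F G H =>
    simp only [mulArgs, List.map_cons, List.map_nil, Multiset.coe_singleton, Multiset.singleton_inj]
    exact Quotient.sound (ACEq.add_assoc F G H)

/-- AC-equivalent formulas have the same multiset of AC-classes of flattened children. [folklore] -/
theorem ACEq.kids_map_mk_eq {F G : PIFormula 𝔽 X} (h : ACEq F G) :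
    (((kids F).map (Quotient.mk (acSetoid 𝔽 X)) : List _) : Multiset (Quotient (acSetoid 𝔽 X))) =
      ((kids G).map (Quotient.mk (acSetoid 𝔽 X)) : List _) := by
  have hl := h.headLabel_eq
  cases F with
  | var x => cases h.eq_of_var; rfl
  | const c => cases h.eq_of_const; rfl
  | add F₁ F₂ =>
    cases G with
    | add G₁ G₂ => simpa [kids, addArgs] using h.addArgs_map_mk_eq
    | _ => simp [headLabel] at hl
  | mul F₁ F₂ =>
    cases G with
    | mul G₁ G₂ => simpa [kids, mulArgs] using h.mulArgs_map_mk_eq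
    | _ => simp [headLabel] at hl

/-! ### The AC-quotient: an unbounded fan-in DAG of classes -/

/-- AC-classes of formulas: `PIFormula 𝔽 X` modulo `ACEq`. [folklore] -/
abbrev ACClass (𝔽 : Type u) (X : Type v) : Type (max u v) := Quotient (acSetoid 𝔽 X)

namespace ACClass

/-- The AC-class of a formula. [folklore] -/
abbrev mk (F : PIFormula 𝔽 X) : ACClass 𝔽 X := Quotient.mk (acSetoid 𝔽 X) F

/-- Two formulas have the same class iff they are AC-equivalent. [folklore] -/
theorem mk_eq_mk {F G : PIFormula 𝔽 X} : mk F = mk G ↔ ACEq F G := Quotient.eq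

/-- The head label of a class (well defined by `ACEq.headLabel_eq`). [folklore] -/
def label : ACClass 𝔽 X → CircuitLabel 𝔽 X :=
  Quotient.lift headLabel fun _ _ h => h.headLabel_eq

/-- The size of a class (well defined by `ACEq.size_eq`). [folklore] -/
def size : ACClass 𝔽 X → ℕ :=
  Quotient.lift PIFormula.size fun _ _ h => h.size_eq

/-- The flattened children of a class, a multiset of classes (well defined by
`ACEq.kids_map_mk_eq`). [folklore] -/
def kids : ACClass 𝔽 X → Multiset (ACClass 𝔽 X) :=
  Quotient.lift (fun F => (((ACStability.kids F).map mk : List (ACClass 𝔽 X)) : Multiset (ACClass 𝔽 X)))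
    fun _ _ h => h.kids_map_mk_eq

/-- `label` on a representative. [folklore] -/
@[simp] theorem label_mk (F : PIFormula 𝔽 X) : (mk F).label = headLabel F := rfl
/-- `size` on a representative. [folklore] -/
@[simp] theorem size_mk (F : PIFormula 𝔽 X) : (mk F).size = F.size := rfl
/-- `kids` on a representative. [folklore] -/
@[simp] theorem kids_mk (F : PIFormula 𝔽 X) :
    (mk F).kids = (((ACStability.kids F).map mk : List (ACClass 𝔽 X)) : Multiset (ACClass 𝔽 X)) := rfl

/-- Every class has positive size. [folklore] -/
theorem one_le_size (q : ACClass 𝔽 X) : 1 ≤ q.size := by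
  induction q using Quotient.inductionOn with
  | h F => exact F.one_le_size

/-- Children are strictly smaller. [folklore] -/
theorem size_lt_of_mem_kids {q k : ACClass 𝔽 X} (h : k ∈ q.kids) : k.size < q.size := by
  induction q using Quotient.inductionOn with
  | h F =>
    simp only [kids_mk, Multiset.mem_coe, List.mem_map] at h
    obtain ⟨K, hK, rfl⟩ := h
    exact ACStability.size_lt_of_mem_kids hK

/-- A class is not among its own children. [folklore] -/
theorem not_mem_kids_self (q : ACClass 𝔽 X) : q ∉ q.kids := fun h =>
  lt_irrefl _ (size_lt_of_mem_kids h)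

/-- An internal class (`+` or `×`) has at least two children. [folklore] -/
theorem two_le_card_kids {q : ACClass 𝔽 X} (h : ¬ q.label.IsInput) : 2 ≤ Multiset.card q.kids := by
  induction q using Quotient.inductionOn with
  | h F => simpa using two_le_length_kids h

/-- A leaf class has no children. [folklore] -/
theorem kids_eq_zero_of_isInput {q : ACClass 𝔽 X} (h : q.label.IsInput) : q.kids = 0 := by
  induction q using Quotient.inductionOn with
  | h F => simp [kids_eq_nil_of_isInput h]

/-- A class with a variable label is the class of that variable. [folklore] -/
theorem eq_mk_var_of_label {q : ACClass 𝔽 X} {x : X} (h : q.label = .var x) : q = mk (.var x) := by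
  induction q using Quotient.inductionOn with
  | h F => cases F <;> simp_all [headLabel]

/-- A class with a constant label is the class of that constant. [folklore] -/
theorem eq_mk_const_of_label {q : ACClass 𝔽 X} {c : 𝔽} (h : q.label = .const c) : q = mk (.const c) := by
  induction q using Quotient.inductionOn with
  | h F => cases F <;> simp_all [headLabel]

section Eval

variable [CommSemiring 𝔽]

/-- The polynomial of a class (well defined by `ACEq.eval_eq`). [folklore] -/
def eval : ACClass 𝔽 X → MvPolynomial X 𝔽 :=
  Quotient.lift PIFormula.eval fun _ _ h => h.eval_eq

/-- `eval` on a representative. [folklore] -/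
@[simp] theorem eval_mk (F : PIFormula 𝔽 X) : (mk F).eval = F.eval := rfl

/-- A `+`-class computes the sum of its children. [folklore] -/
theorem eval_eq_sum_of_label_add {q : ACClass 𝔽 X} (h : q.label = .add) :
    q.eval = (q.kids.map eval).sum := by
  induction q using Quotient.inductionOn with
  | h F =>
    cases F with
    | add F G =>
      simp only [eval_mk, kids_mk, kids_add, Multiset.map_coe, List.map_map, Multiset.sum_coe]
      rw [eval_eq_sum_addArgs (PIFormula.add F G), addArgs_add]
      rfl
    | _ => simp [headLabel] at h

/-- A `×`-class computes the product of its children. [folklore] -/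
theorem eval_eq_prod_of_label_mul {q : ACClass 𝔽 X} (h : q.label = .mul) :
    q.eval = (q.kids.map eval).prod := by
  induction q using Quotient.inductionOn with
  | h F =>
    cases F with
    | mul F G =>
      simp only [eval_mk, kids_mk, kids_mul, Multiset.map_coe, List.map_map, Multiset.prod_coe]
      rw [eval_eq_prod_mulArgs (PIFormula.mul F G), mulArgs_mul]
      rfl
    | _ => simp [headLabel] at h

/-- A variable class computes the variable. [folklore] -/
theorem eval_of_label_var {q : ACClass 𝔽 X} {x : X} (h : q.label = .var x) : q.eval = MvPolynomial.X x := by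
  rw [eq_mk_var_of_label h]; rfl

/-- A constant class computes the constant. [folklore] -/
theorem eval_of_label_const {q : ACClass 𝔽 X} {c : 𝔽} (h : q.label = .const c) :
    q.eval = MvPolynomial.C c := by
  rw [eq_mk_const_of_label h]; rfl

end Eval

end ACClass

end ACStability

open Literature.Computability.AlgebraicComplexity in
/-- **The AC-quotient is an unbounded fan-in DAG computing the right polynomials** (registered
helper of stub S3 `stub_stabilityAtACBudget`, crux `RestorationQP`): a `+`-class computes the sum,
with multiplicities, of the polynomials of its flattened children. [folklore] -/
theorem stabilityAtACBudget_aux_evalKids : ∀ (n : ℕ) (q : ACStability.ACClass ℂ (Fin n × Fin n)), q.label = CircuitLabel.add → q.eval = (q.kids.map ACStability.ACClass.eval).sum := by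
  intro n q h
  exact ACStability.ACClass.eval_eq_sum_of_label_add h

end Summit.ValiantsHypothesis.ValiantsHypothesis.Theorems

end
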